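import Summits.Ventures.PercRepro.ProfilePointedCircuitClassesStarSharpParA

/-!
# PercRepro — THE PARALLEL REGIME `b ∥ e` OF CASE D0 WITH AT MOST THREE DEFECTS
(p5, gen 55; `proofs/P5-GM1.md` §82 ADD 4)

`inCount_thru_le_of_par_e_of_le_three_bad`: `ρ{e, b, b′} = 2`, `ρ{b, b′} = 2` (every set through `e` is ON, so
every demand is ON and every C-point target is ON); the demands split into the swaps (`d0_injR0`), the demands with
`ρ(π + e + f) = 4` and an OFF complement (`d0_injR2''`, the bi-bases with an ON pair) and the rest, which are defects
of `R` (the swap `π + f + b` is OFF iff `e ∉ cl(π + f)`, i.e. `ρ(π + e + f) = 4`, and then the complement is ON iff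
`e ∈ cl(X − π)`); the generic count bounds them by the C-point targets when they are at most three.
-/

open scoped Matroid

namespace PercRepro.Cogirth

open Finset ThmH Skew Shadow Profile

open Classical

variable {α : Type} [DecidableEq α] {N : Matroid α} [N.Finite]

section StarSharpParB

variable {b b' : α}

/-- **THE REGIME `b ∥ e` WITH AT MOST THREE DEFECTS**. -/
theorem inCount_thru_le_of_par_e_of_le_three_bad (hn : (gr N).card = 9) (h : SeriesPair N b b')
    {e f : α} (he : e ∈ gr N) (hf : f ∈ gr N) (hef : e ≠ f) (heb : e ≠ b) (heb' : e ≠ b') (hfb : f ≠ b) (hfb' : f ≠ b')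
    (he1 : ∀ y ∈ ((((gr N).erase b).erase b').erase f).erase e, rk N {e, y} = 2)
    (hf1 : ∀ y ∈ ((((gr N).erase b).erase b').erase f).erase e, rk N {f, y} = 2)
    (hfc : ∀ y ∈ ((((gr N).erase b).erase b').erase f).erase e, rk N (((((gr N).erase b).erase b').erase f).erase y) = 4)
    (hX : rk N (((((gr N).erase b).erase b').erase f).erase e) = 4) (hef2 : rk N {e, f} = 2)
    (hpe : rk N {e, b, b'} = 2) (hbb2 : rk N {b, b'} = 2)
    (hthree : ∀ W₁ ∈ d0DON N b' e f, ∀ W₂ ∈ d0DON N b' e f, ∀ W₃ ∈ d0DON N b' e f, ∀ W₄ ∈ d0DON N b' e f,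
      ¬ d0c0 N b b' e f W₁ ∧ ¬ (d0c1 N b e f W₁ ∧ d0c2 N b b' e f W₁) →
      ¬ d0c0 N b b' e f W₂ ∧ ¬ (d0c1 N b e f W₂ ∧ d0c2 N b b' e f W₂) →
      ¬ d0c0 N b b' e f W₃ ∧ ¬ (d0c1 N b e f W₃ ∧ d0c2 N b b' e f W₃) →
      ¬ d0c0 N b b' e f W₄ ∧ ¬ (d0c1 N b e f W₄ ∧ d0c2 N b b' e f W₄) →
      W₁ = W₂ ∨ W₁ = W₃ ∨ W₁ = W₄ ∨ W₂ = W₃ ∨ W₂ = W₄ ∨ W₃ = W₄) :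
    inCount N 4 e + thruCount N 4 {b', f} + thruCount N 4 {b', e, f} ≤
      inCount N 4 f + thruCount N 4 {e, f} + thruCount N 4 {b', e} := by
  have hfE : f ∈ ((gr N).erase b).erase b' := mem_erase.2 ⟨hfb', mem_erase.2 ⟨hfb, hf⟩⟩
  have heE : e ∈ ((gr N).erase b).erase b' := mem_erase.2 ⟨heb', mem_erase.2 ⟨heb, he⟩⟩
  have hXE : ((((gr N).erase b).erase b').erase f).erase e ⊆ ((gr N).erase b).erase b' :=
    (erase_subset _ _).trans (erase_subset _ _)
  have hbb' : b ≠ b' := h.2.2.1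
  have he1' : rk N ({e} : Finset α) = 1 := by
    have h1 := rk_insert_le_add_one (N := N) hf (X := ({e} : Finset α)) (singleton_subset_iff.2 he)
    have h2 := rk_le_card' (M := N) ({e} : Finset α)
    rw [card_singleton] at h2
    rw [pair_comm'] at hef2
    rw [hef2] at h1
    omega
  have hon : ∀ S : Finset α, S ⊆ ((gr N).erase b).erase b' → e ∈ S → rk N (insert b (insert b' S)) = rk N S + 1 := by
    intro S hS heS
    rw [on_iff_of_parallel h heE he1' hpe hbb2 hS, insert_eq_of_mem heS]
  have hdata := d0_demand_data h hn hf hef heb hfb hfb' (e := e)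
  -- THE ASSEMBLY (as in D0R)
  rw [inCount_thru_split']
  have hsplit := card_filter_add_card_filter_not (s := (biIndepSets N 4).filter (fun W => (e ∈ W ∧ f ∉ W) ∧ b' ∉ W))
    (fun W => (gr N \ W).erase b' ∈ biIndepSets N 4)
  simp only [filter_filter] at hsplit
  have htar : ((biIndepSets N 4).filter (fun W => (f ∈ W ∧ b' ∉ W) ∧ (e ∉ W ∧ (gr N \ W).erase b' ∈ biIndepSets N 4))).card +
      ((biIndepSets N 4).filter (fun W => (f ∈ W ∧ b' ∉ W) ∧ (e ∉ W ∧ b ∈ W ∧ ¬ (gr N \ W).erase b' ∈ biIndepSets N 4))).card +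
      ((biIndepSets N 4).filter (fun W => (f ∈ W ∧ b' ∉ W) ∧ (e ∈ W ∧ b ∉ W))).card +
      ((biIndepSets N 4).filter (fun W => (f ∈ W ∧ b' ∉ W) ∧ (e ∈ W ∧ b ∈ W ∧ ¬ (gr N \ W).erase b' ∈ biIndepSets N 4))).card ≤
      ((biIndepSets N 4).filter (fun W => f ∈ W ∧ b' ∉ W)).card := by
    rw [← card_union_of_disjoint, ← card_union_of_disjoint, ← card_union_of_disjoint]
    · apply card_le_card
      intro W hW
      simp only [mem_union, mem_filter] at hW ⊢
      rcases hW with ((hW | hW) | hW) | hW <;> exact ⟨hW.1, hW.2.1⟩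
    · rw [disjoint_union_left, disjoint_union_left]
      refine ⟨⟨?_, ?_⟩, ?_⟩ <;> rw [disjoint_filter]
      · rintro W _ ⟨-, heW, -⟩ ⟨-, heW', -, -⟩; exact heW heW'
      · rintro W _ ⟨-, heW, -, -⟩ ⟨-, heW', -, -⟩; exact heW heW'
      · rintro W _ ⟨-, -, hbW⟩ ⟨-, -, hbW', -⟩; exact hbW hbW'
    · rw [disjoint_union_left]
      refine ⟨?_, ?_⟩ <;> rw [disjoint_filter]
      · rintro W _ ⟨-, heW, -⟩ ⟨-, heW', -⟩; exact heW heW'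
      · rintro W _ ⟨-, heW, -, -⟩ ⟨-, heW', -⟩; exact heW heW'
    · rw [disjoint_filter]
      rintro W _ ⟨-, -, hc⟩ ⟨-, -, -, hc'⟩; exact hc' hc
  have hinj1 := card_off_demands_le (N := N) (b' := b') (e := e) hf hfb'
  have hs1 := card_filter_add_card_filter_not (s := d0DON N b' e f) (fun W => d0c0 N b b' e f W)
  have hs2 := card_filter_add_card_filter_not (s := (d0DON N b' e f).filter (fun W => ¬ d0c0 N b b' e f W))
    (fun W => d0c1 N b e f W ∧ d0c2 N b b' e f W)
  simp only [filter_filter] at hs2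
  have hshape : (d0DON N b' e f).filter (fun W => ¬ d0c0 N b b' e f W ∧ (d0c1 N b e f W ∧ d0c2 N b b' e f W)) =
      (d0DON N b' e f).filter (fun W => (¬ d0c0 N b b' e f W ∧ d0c1 N b e f W) ∧ d0c2 N b b' e f W) :=
    filter_congr (fun W _ => and_assoc.symm)
  rw [hshape] at hs2
  have hinjR0 := d0_injR0 h hn he hf hef heb heb' hfb hfb'
  have hinjR2 := d0_injR2'' hn h he hf hef heb heb' hfb hfb'
  have hsB := card_filter_add_card_filter_not
    (s := (biIndepSets N 4).filter (fun W => (f ∈ W ∧ b' ∉ W) ∧ (e ∈ W ∧ b ∉ W)))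
    (fun B => insert b (B.erase f) ∈ biIndepSets N 4 ∧ rk N (insert b (insert b' (B.erase f))) = 4)
  simp only [filter_filter] at hsB
  have hDON : (d0DON N b' e f).card = ((biIndepSets N 4).filter (fun W => ((e ∈ W ∧ f ∉ W) ∧ b' ∉ W) ∧
      ¬ (gr N \ W).erase b' ∈ biIndepSets N 4)).card := rfl
  rw [← hDON] at hsplit
  -- THE DEFECTS
  have hbad : ((d0DON N b' e f).filter (fun W => ¬ d0c0 N b b' e f W ∧ ¬ (d0c1 N b e f W ∧ d0c2 N b b' e f W))).card ≤
      ((biIndepSets N 4).filter (fun W => (f ∈ W ∧ b' ∉ W) ∧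
        (e ∈ W ∧ b ∈ W ∧ ¬ (gr N \ W).erase b' ∈ biIndepSets N 4))).card := by
    apply card_bad_le_targets_of_card_le_three_P hn h he hf hef heb heb' hfb hfb' he1 hf1 hfc hX hef2
      (P := fun W => ¬ d0c0 N b b' e f W ∧ ¬ (d0c1 N b e f W ∧ d0c2 N b b' e f W))
    · intro W hW
      have hW' := mem_filter.1 hW
      have hWd := hW'.1
      simp only [d0DON, mem_filter] at hWd
      obtain ⟨-, hπX, hπ2, -, -, hYr, hYc, -⟩ := hdata W hWd.1 hWd.2.1 hWd.2.2
      rintro ⟨h1, h2⟩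
      -- the swap is OFF, so `ρ(π + e + f) = 4` (c1); then the complement is ON (¬ c2), against `h2`
      have hoffswap : ¬ rk N (insert b (insert b' (insert f ((W.erase b).erase e)))) = 4 := fun h' =>
        hW'.2.1 ⟨h1, h2, h'⟩
      have hsubE : insert f ((W.erase b).erase e) ⊆ ((gr N).erase b).erase b' := insert_subset hfE (hπX.trans hXE)
      have hc1 : d0c1 N b e f W := by
        unfold d0c1
        have h3 : ¬ rk N (insert e (insert f ((W.erase b).erase e))) = rk N (insert f ((W.erase b).erase e)) := by
          intro h4
          apply hoffswap
          rw [(on_iff_of_parallel h heE he1' hpe hbb2 hsubE).2 h4, h1]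
        have h4 := rk_insert_le_add_one (N := N) he (X := insert f ((W.erase b).erase e))
          (hsubE.trans ((erase_subset _ _).trans (erase_subset _ _)))
        have h5 : rk N (insert f ((W.erase b).erase e)) ≤ rk N (insert e (insert f ((W.erase b).erase e))) :=
          rk_mono' (subset_insert _ _)
        rw [insert_f_insert_e_comm]
        omega
      have hnc2 : ¬ d0c2 N b b' e f W := fun h' => hW'.2.2 ⟨hc1, h'⟩
      apply hnc2
      unfold d0c2
      have hXπE : ((((gr N).erase b).erase b').erase f).erase e \ (W.erase b).erase e ⊆ ((gr N).erase b).erase b' :=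
        sdiff_subset.trans hXE
      have h3 := rk_insert_bb'_bounds h hXπE
      have h4 : rk N (((((gr N).erase b).erase b').erase f).erase e \ (W.erase b).erase e) = 3 :=
        d0_S3 h hn he hf hef heb heb' hfb hfb' _ hπX hπ2 hYc
      have h5 : ¬ rk N (insert b (insert b' (((((gr N).erase b).erase b').erase f).erase e \ (W.erase b).erase e))) =
          rk N (((((gr N).erase b).erase b').erase f).erase e \ (W.erase b).erase e) + 1 := by
        rw [on_iff_of_parallel h heE he1' hpe hbb2 hXπE]
        omega
      omega
    · intro x hx hefx hx4
      have hS : ({e, f, x} : Finset α) ⊆ ((gr N).erase b).erase b' := by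
        intro w hw; simp only [mem_insert, mem_singleton] at hw
        rcases hw with rfl | rfl | rfl
        · exact heE
        · exact hfE
        · exact hXE hx
      have hS3' : ({e, f, x} : Finset α).card = 3 := by
        have hxe : x ≠ e := (mem_erase.1 hx).1
        have hxf : x ≠ f := (mem_erase.1 (mem_erase.1 hx).2).1
        rw [card_insert_of_notMem, card_pair hxf.symm]
        simp only [mem_insert, mem_singleton, not_or]; exact ⟨hef, hxe.symm⟩
      simp only [mem_filter]
      refine ⟨?_, ⟨mem_insert_of_mem (mem_insert_of_mem (mem_insert_self _ _)), ?_⟩,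
        mem_insert_of_mem (mem_insert_self _ _), mem_insert_self _ _, ?_⟩
      · rw [insert_b_mem_biIndepSets_iff h hn hS hS3', E7_sdiff_efx_eq]
        exact ⟨hefx, hx4⟩
      · intro h'
        simp only [mem_insert, mem_singleton] at h'
        rcases h' with h2 | h2 | h2 | h2
        · exact hbb' h2.symm
        · exact heb' h2.symm
        · exact hfb' h2.symm
        · exact (mem_erase.1 (hXE hx)).1 h2.symm
      · rw [off_image_efx_iff h hn he hf hef heb heb' hfb hfb' hx]
        rintro ⟨-, h5⟩
        have := hon ({e, f, x} : Finset α) hS (mem_insert_self _ _)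
        rw [hefx] at this
        omega
    · apply card_le_three_of_no_four
      intro x hx y hy z hz w hw
      simp only [mem_filter] at hx hy hz hw
      exact hthree x hx.1 y hy.1 z hz.1 w hw.1 hx.2 hy.2 hz.2 hw.2
  have hs2' : ((d0DON N b' e f).filter (fun W => (¬ d0c0 N b b' e f W ∧ d0c1 N b e f W) ∧ d0c2 N b b' e f W)).card +
      ((d0DON N b' e f).filter (fun W => ¬ d0c0 N b b' e f W ∧ ¬ (d0c1 N b e f W ∧ d0c2 N b b' e f W))).card =
      ((d0DON N b' e f).filter (fun W => ¬ d0c0 N b b' e f W)).card := by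
    rw [← hs2]
  have hsum := Nat.add_le_add hinjR0 (Nat.add_le_add hinjR2 hbad)
  omega

end StarSharpParB

end PercRepro.Cogirth
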